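import Literature.AlgebraicGeometry.Resolution.MuPTorsorLocalUniformization
import HarnessLib

/-!
# The dual (quotient) form of the `μ_p`-torsor reduction of local uniformization: Frobenius sandwich

Topic: `Literature/AlgebraicGeometry/Resolution`. Companion to `MuPTorsorLocalUniformization.lean`
(Temkin 2013, Rem. 1.3.5 (ii)–(iii) over perfect ground fields:
`Temkin2013 → (LocalUniformizationPerfectInChar p ↔ MuPTorsorLocalUniformization p)`).

## What is proved

(Everything; no named fact is consumed except `Temkin2013` in the corollaries that say so.)

Over a PERFECT field `k` of characteristic `p`, a degree-`p` purely inseparable extension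
`K₀ ⊆ K₁ = K₀(a^{1/p})` sits in the FROBENIUS SANDWICH `K₁^p ⊆ K₀ ⊆ K₁`, and the `p`-th power map
is a field isomorphism `K₁ ≅ K₁^p`, semilinear over `k` (Frobenius of `k` is onto), which carries a
valuation ring `O ∩ K₁` onto `O ∩ K₁^p` and affine regular models onto affine regular models
(`IsLocallyUniformizable.of_ringEquiv` of the companion file). Consequently the two "one-step"
problems

* ASCENT (`MuPTorsorStepsAt p k O`, the companion file; Temkin's "valuations on `μ_p`-torsors over
  regular varieties"): `O ∩ K₀` uniformizable ⇒ `O ∩ K₀(a^{1/p})` uniformizable, and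
* DESCENT (`MuPQuotientStepsAt p k O`, this file; "valuations on QUOTIENTS of regular varieties by
  `p`-closed rational vector fields", since the subfields `K₀ ⊇ K₁^p·k = K₁^p` of `K₁` of index `p`
  are exactly the fields of constants `K₁^D` of the `p`-closed `k`-derivations `D ≠ 0` of `K₁`,
  Jacobson's purely inseparable Galois correspondence of exponent one):
  `O ∩ K₀(a^{1/p})` uniformizable ⇒ `O ∩ K₀` uniformizable (for `K₀` finitely generated over `k`),

are EQUIVALENT, valuation ring by valuation ring and unconditionally
(`muPTorsorStepsAt_iff_muPQuotientStepsAt`): a torsor step `K₀ ↗ K₁` is the Frobenius transport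
`K₁^p ≅ K₁` preceded by the descent `K₀ ↘ K₁^p` (an exponent-one descent, i.e. finitely many
quotient steps), and a quotient step `K₁ ↘ K₀` is the transport `K₁ ≅ K₁^p` followed by the ascent
`K₁^p ↗ K₀` (finitely many torsor steps, `K₀` being finitely generated with `K₀^p ⊆ K₁^p`). Hence
(`muPTorsorLocalUniformization_iff_muPQuotient`) `MuPTorsorLocalUniformization p ↔
MuPQuotientLocalUniformization p` for every prime `p`, and, granted Temkin's inseparable local
uniformization (`Temkin2013`, Thm. 1.3.2 of the source below, a named fact used as a hypothesis),
local uniformization over perfect fields of characteristic `p` is equivalent to its QUOTIENT case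
(`localUniformizationPerfectInChar_iff_muPQuotient`), and is needed only at valuations of positive
transcendence defect (`localUniformizationPerfectInChar_iff_posDefect_muPQuotient`).

Geometric reading (not formalised here; it is why the dual form is worth recording). A torsor
step resolves, along a valuation, the hypersurface `t^p = f` over a regular local ring `A₀ ∋ f` of
`K₀`; the dual step resolves, along the same valuation, the ring of invariants `B^D = B ∩ K₀` of a
REGULAR local ring `B` of `K₁` under a `p`-closed derivation `D` (`K₀ = K₁^D`). `B^D` is regular as
soon as the saturated foliation `B·D ∩ Der_k(B)` is non-singular at the closed point (then
`B = ⊕_{i<p} B^D y^i` is free over `B^D`), so the dual problem is LOCAL UNIFORMIZATION OF `p`-CLOSED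
ONE-DIMENSIONAL FOLIATIONS on regular varieties: make the foliation non-singular (or of
multiplicative type, whose `μ_p`-quotient singularities are toroidal) at the centre of the
valuation by blowing up regular centres. Sources for the dictionary: N. Jacobson, *Galois
theory of purely inseparable fields of exponent one*, Amer. J. Math. 66 (1944) 645–648, in the
textbook form N. Jacobson, *Basic Algebra II* (2nd ed.), §8.17, Thm. 8.45 (finite-dimensional
`p`-`E`-Lie algebras of derivations of `E` ↔ subfields `F` with `E/F` finite of exponent `≤ 1`,
`F = ` the constants) [page-checked in the held copy `book:jacobsonnd-basic-algebra-ii`], and in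
the geometric form ("Jacobson correspondence": 1-foliations of rank `r` on a normal variety `X`
↔ factorisations `X → Y → X^{(-1)}` of the `k`-linear Frobenius with `Y` normal, `deg = p^r`)
of Q. Posva, *On the singularities of quotients by 1-foliations*, Nagoya Math. J. (2025),
arXiv:2311.16694, §2 [page-checked], where one also finds, with proofs, the regularity criterion
(`X` regular: `X/F` regular ↔ `F` regular; attributed to Miyaoka–Peternell) and the normal form
of multiplicative derivations (quotient of a regular local ring by a multiplicative `p`-closed
derivation is formally toric; attributed to A. N. Rudakov, I. R. Shafarevich, *Inseparable
morphisms of algebraic surfaces*, Izv. Akad. Nauk SSSR Ser. Mat. 40 (1976) 1269–1307); further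
T. Ekedahl, *Foliations and inseparable morphisms*, Proc. Sympos. Pure Math. 46 (1987) 139–149
(the smooth global theory) and Q. Posva, *Resolution of 1-foliations singularities on surfaces and
threefolds*, arXiv:2405.05735 (2024).

## Contents

* `pRadical p N = {x | x^p ∈ N}` (an intermediate field), `mem_pRadical`,
  `pow_mem_of_mem_sup_adjoin`
  (`x ∈ K₀(S)`, `S^p ⊆ K₀` ⇒ `x^p ∈ K₀`: the sandwich `K₀(a^{1/p})^p ⊆ K₀`);
* `frobImage p K₁ = K₁^p` (an intermediate field over the perfect `k`), `mem_frobImage`,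
  `frobImage_le`, `pow_mem_frobImage`, `frobImage_fg` (`k(t)^p = k(t^p)`), and the transport
  `isLocallyUniformizable_frobImage_iff` (`O ∩ K₁` uniformizable ↔ `O ∩ K₁^p` uniformizable);
* `MuPQuotientStepsAt`, `MuPQuotientLocalUniformization` (definitions), `muPQuotient_tower_at`,
  `MuPQuotientStepsAt.descend` (descent along any exponent-one subextension `K₀ ⊆ K₁`, `K₁^p ⊆ K₀`);
* `MuPQuotientStepsAt.muPTorsorStepsAt`, `MuPTorsorStepsAt.muPQuotientStepsAt`,
  `muPTorsorStepsAt_iff_muPQuotientStepsAt`, `muPTorsorLocalUniformization_iff_muPQuotient`,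
  `LocalUniformizationPerfectInChar.muPQuotient`,
  `MuPQuotientLocalUniformization.localUniformizationPerfect`,
  `localUniformizationPerfectInChar_iff_muPQuotient`,
  `localUniformizationPerfectInChar_iff_posDefect_muPQuotient`.

[cite: Temkin2013, Rem. 1.3.5 (ii)-(iii) (arXiv:0804.1554v3 p. 4); the dual form and the
valuation-wise equivalence are this file's (folklore-level) addition]
-/

noncomputable section

open IsLocalRing

namespace Literature.AlgebraicGeometry.Resolution

universe u

/-! ## The `p`-radical of an intermediate field -/

section PRadical

variable {p : ℕ} {k K : Type u} [Field k] [Field K] [Algebra k K]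

/-- `pRadical p N = {x : K | x ^ p ∈ N}`, an intermediate field (the preimage of `N` under the
Frobenius endomorphism of `K`; it contains `k` because `N` does). [folklore] -/
def pRadical (p : ℕ) [ExpChar K p] (N : IntermediateField k K) : IntermediateField k K :=
  (N.toSubfield.comap (frobenius K p)).toIntermediateField fun c => by
    show frobenius K p (algebraMap k K c) ∈ N.toSubfield
    rw [frobenius_def]
    exact pow_mem (N.algebraMap_mem c) p

/-- Membership in the `p`-radical: `x ∈ pRadical p N ↔ x ^ p ∈ N`. [folklore] -/
theorem mem_pRadical [ExpChar K p] {N : IntermediateField k K} {x : K} :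
    x ∈ pRadical p N ↔ x ^ p ∈ N := by
  show frobenius K p x ∈ N.toSubfield ↔ _
  rw [frobenius_def]
  rfl

/-- `N ⊆ pRadical p N`. [folklore] -/
theorem le_pRadical_self [ExpChar K p] (N : IntermediateField k K) : N ≤ pRadical p N :=
  fun _ hx => mem_pRadical.mpr (pow_mem hx p)

/-- If `S^p ⊆ N` then `k(S) ⊆ pRadical p N`. [folklore] -/
theorem adjoin_le_pRadical [ExpChar K p] {N : IntermediateField k K} {S : Set K}
    (hS : ∀ a ∈ S, a ^ p ∈ N) : IntermediateField.adjoin k S ≤ pRadical p N :=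
  IntermediateField.adjoin_le_iff.mpr fun a ha => mem_pRadical.mpr (hS a ha)

/-- **The Frobenius sandwich**: if `S^p ⊆ N` then `N(S)^p ⊆ N`. [folklore] -/
theorem pow_mem_of_mem_sup_adjoin [ExpChar K p] {N : IntermediateField k K} {S : Set K}
    (hS : ∀ a ∈ S, a ^ p ∈ N) {x : K} (hx : x ∈ N ⊔ IntermediateField.adjoin k S) : x ^ p ∈ N :=
  mem_pRadical.mp (sup_le (le_pRadical_self N) (adjoin_le_pRadical hS) hx)

/-- `K₀(a^{1/p})^p ⊆ K₀`: for `a ^ p ∈ K₀` and `x ∈ K₀(a)`, `x ^ p ∈ K₀`. [folklore] -/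
theorem pow_mem_of_mem_sup_adjoin_simple [ExpChar K p] {N : IntermediateField k K} {a : K}
    (ha : a ^ p ∈ N) {x : K} (hx : x ∈ N ⊔ IntermediateField.adjoin k {a}) : x ^ p ∈ N :=
  pow_mem_of_mem_sup_adjoin (fun b hb => by rw [Set.mem_singleton_iff.mp hb]; exact ha) hx

end PRadical

/-! ## The Frobenius image of an intermediate field over a perfect field -/

section FrobImage

variable {p : ℕ} {k K : Type u} [Field k] [Field K] [Algebra k K]
  [ExpChar k p] [PerfectRing k p] [ExpChar K p]

/-- The Frobenius image `K₁^p = {y ^ p | y ∈ K₁}` of an intermediate field `K₁` of `K/k`, `k`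
perfect: an intermediate field (it contains `k = k^p`). [folklore] -/
def frobImage (p : ℕ) [ExpChar k p] [PerfectRing k p] [ExpChar K p] (K₁ : IntermediateField k K) :
    IntermediateField k K :=
  ((frobenius K p).comp (algebraMap K₁ K)).fieldRange.toIntermediateField fun c =>
    RingHom.mem_fieldRange.mpr ⟨algebraMap k K₁ ((frobeniusEquiv k p).symm c), by
      rw [RingHom.comp_apply, ← IsScalarTower.algebraMap_apply, frobenius_def, ← map_pow,
        frobeniusEquiv_symm_pow_p]⟩

/-- Membership in the Frobenius image: `x ∈ K₁^p ↔ ∃ y ∈ K₁, y ^ p = x`. [folklore] -/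
theorem mem_frobImage {K₁ : IntermediateField k K} {x : K} :
    x ∈ frobImage p K₁ ↔ ∃ y : K₁, (y : K) ^ p = x := by
  show x ∈ ((frobenius K p).comp (algebraMap K₁ K)).fieldRange ↔ _
  rw [RingHom.mem_fieldRange]
  rfl

/-- `x ∈ K₁ ⇒ x ^ p ∈ K₁^p`. [folklore] -/
theorem pow_mem_frobImage {K₁ : IntermediateField k K} {x : K} (hx : x ∈ K₁) :
    x ^ p ∈ frobImage p K₁ :=
  mem_frobImage.mpr ⟨⟨x, hx⟩, rfl⟩

/-- `K₁^p ⊆ K₀` as soon as `x^p ∈ K₀` for all `x ∈ K₁`. [folklore] -/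
theorem frobImage_le {K₀ K₁ : IntermediateField k K} (h : ∀ x ∈ K₁, x ^ p ∈ K₀) :
    frobImage p K₁ ≤ K₀ := by
  intro x hx
  obtain ⟨y, rfl⟩ := mem_frobImage.mp hx
  exact h y y.2

/-- `k(t)^p = k(t^p)`; in particular the Frobenius image of a finitely generated intermediate
field is finitely generated. [folklore] -/
theorem frobImage_fg {K₁ : IntermediateField k K} (h : K₁.FG) : (frobImage p K₁).FG := by
  classical
  obtain ⟨t, ht⟩ := h
  refine ⟨t.image fun x => x ^ p, le_antisymm ?_ ?_⟩
  · rw [IntermediateField.adjoin_le_iff]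
    intro x hx
    rw [Finset.coe_image] at hx
    obtain ⟨g, hg, rfl⟩ := hx
    exact pow_mem_frobImage (ht ▸ IntermediateField.subset_adjoin k _ hg)
  · intro x hx
    obtain ⟨y, rfl⟩ := mem_frobImage.mp hx
    have hy : (y : K) ∈ IntermediateField.adjoin k (t : Set K) := ht ▸ y.2
    have hle : IntermediateField.adjoin k (t : Set K) ≤
        pRadical p (IntermediateField.adjoin k ((t.image fun x => x ^ p : Finset K) : Set K)) :=
      adjoin_le_pRadical fun a ha => IntermediateField.subset_adjoin k _ (by
        rw [Finset.coe_image]; exact ⟨a, ha, rfl⟩)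
    exact mem_pRadical.mp (hle hy)

/-- **Frobenius transport of local uniformization**: `O ∩ K₁` is locally uniformizable over the
perfect field `k` iff `O ∩ K₁^p` is — the `p`-th power map `K₁ ≅ K₁^p` is a ring isomorphism,
semilinear over `k` for the Frobenius automorphism of `k`, matching the two valuation rings
(`y ∈ O ↔ y^p ∈ O`). [folklore] -/
theorem isLocallyUniformizable_frobImage_iff (hp : 0 < p) (O : ValuationSubring K)
    (K₁ : IntermediateField k K) :
    IsLocallyUniformizable k K₁ (O.comap (algebraMap K₁ K)) ↔
      IsLocallyUniformizable k (frobImage p K₁) (O.comap (algebraMap (frobImage p K₁) K)) := by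
  set M : IntermediateField k K := frobImage p K₁ with hMdef
  let φ : K₁ →+* K := (frobenius K p).comp (algebraMap K₁ K)
  have hφ : ∀ y : K₁, φ y = (y : K) ^ p := fun y => rfl
  let φ₀ : K₁ →+* M := φ.codRestrict M fun y => mem_frobImage.mpr ⟨y, rfl⟩
  have hφ₀ : Function.Bijective φ₀ := by
    refine ⟨fun a b hab => ?_, fun x => ?_⟩
    · have h1 : φ a = φ b := congrArg Subtype.val hab
      rw [hφ, hφ] at h1
      exact Subtype.ext (frobenius_inj K p h1)
    · obtain ⟨y, hy⟩ := mem_frobImage.mp x.2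
      exact ⟨y, Subtype.ext hy⟩
  let e : K₁ ≃+* M := RingEquiv.ofBijective φ₀ hφ₀
  have he_val : ∀ y : K₁, ((e y : M) : K) = (y : K) ^ p := fun y => rfl
  let σ : k ≃+* k := frobeniusEquiv k p
  have he : ∀ c : k, e (algebraMap k K₁ c) = algebraMap k M (σ c) := by
    intro c
    apply Subtype.ext
    rw [he_val]
    show (algebraMap k K c) ^ p = algebraMap k K (σ c)
    rw [frobeniusEquiv_def, map_pow]
  have he' : ∀ c : k, e.symm (algebraMap k M c) = algebraMap k K₁ (σ.symm c) := by
    intro c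
    apply e.injective
    rw [RingEquiv.apply_symm_apply, he, RingEquiv.apply_symm_apply]
  constructor
  · intro h
    refine IsLocallyUniformizable.of_ringEquiv e σ he _ ?_
    have hc : (O.comap (algebraMap M K)).comap (e : K₁ →+* M) = O.comap (algebraMap K₁ K) := by
      ext y
      show ((e y : M) : K) ∈ O ↔ (y : K) ∈ O
      rw [he_val]
      exact ⟨fun h => mem_valuationSubring_of_pow_mem O hp h, fun h => pow_mem h p⟩
    rw [hc]
    exact h
  · intro h
    refine IsLocallyUniformizable.of_ringEquiv e.symm σ.symm he' _ ?_
    have hc : (O.comap (algebraMap K₁ K)).comap (e.symm : M →+* K₁) = O.comap (algebraMap M K) := by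
      ext x
      show ((e.symm x : K₁) : K) ∈ O ↔ (x : K) ∈ O
      have hx : (x : K) = ((e.symm x : K₁) : K) ^ p := by
        rw [← he_val, RingEquiv.apply_symm_apply]
      rw [hx]
      exact ⟨fun h => pow_mem h p, fun h => mem_valuationSubring_of_pow_mem O hp h⟩
    rw [hc]
    exact h

end FrobImage

/-! ## Statements: the quotient (descent) form -/

/-- **The `μ_p`-QUOTIENT hypothesis at ONE ambient valuation ring** `O` of `K ⊇ k`: for every
finitely generated intermediate field `K₀` and `a ∈ K` with `a ^ p ∈ K₀`, if `O ∩ K₀(a)` is locally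
uniformizable over `k` then so is `O ∩ K₀`. Dual to `MuPTorsorStepsAt` (same data, implication
reversed): `K₀ = K₀(a)^D` is the field of constants of a `p`-closed derivation of `K₀(a)`, so this
is local uniformization of valuations on quotients of (uniformizable, e.g. regular) varieties by
`p`-closed rational vector fields. [folklore] -/
def MuPQuotientStepsAt (p : ℕ) (k : Type u) {K : Type u} [Field k] [Field K] [Algebra k K]
    (O : ValuationSubring K) : Prop :=
  ∀ (K₀ : IntermediateField k K) (a : K), K₀.FG → a ^ p ∈ K₀ →
    IsLocallyUniformizable k ↥(K₀ ⊔ IntermediateField.adjoin k {a})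
      (O.comap (algebraMap ↥(K₀ ⊔ IntermediateField.adjoin k {a}) K)) →
    IsLocallyUniformizable k K₀ (O.comap (algebraMap K₀ K))

/-- **Local uniformization of valuations on `μ_p`-quotients** (the dual of
`MuPTorsorLocalUniformization p`): over every perfect field `k` of characteristic `p`, every
valuation ring of every `K ⊇ k` satisfies `MuPQuotientStepsAt p k O`. [folklore] -/
def MuPQuotientLocalUniformization (p : ℕ) : Prop :=
  ∀ (k K : Type u) [Field k] [CharP k p] [PerfectField k] [Field K] [Algebra k K]
    (O : ValuationSubring K), MuPQuotientStepsAt p k O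

/-! ## Descent along an exponent-one subextension, one quotient step at a time -/

section Tower

variable {p : ℕ} {k K : Type u} [Field k] [Field K] [Algebra k K]

/-- If `g ^ p ∈ K₀` for all `g ∈ t`, `K₀` is finitely generated and `O ∩ K₀(t)` is uniformizable,
so is `O ∩ K₀` — remove the generators one at a time. [folklore] -/
theorem muPQuotient_tower_at (O : ValuationSubring K) (H : MuPQuotientStepsAt p k O)
    (K₀ : IntermediateField k K) (hK₀ : K₀.FG) (t : Finset K) (ht : ∀ g ∈ t, g ^ p ∈ K₀)
    (h : IsLocallyUniformizable k ↥(K₀ ⊔ IntermediateField.adjoin k (t : Set K))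
      (O.comap (algebraMap ↥(K₀ ⊔ IntermediateField.adjoin k (t : Set K)) K))) :
    IsLocallyUniformizable k K₀ (O.comap (algebraMap K₀ K)) := by
  classical
  induction t using Finset.induction_on with
  | empty =>
    have hK : K₀ ⊔ IntermediateField.adjoin k ((∅ : Finset K) : Set K) = K₀ := by
      rw [Finset.coe_empty, IntermediateField.adjoin_empty, sup_bot_eq]
    rw [hK] at h
    exact h
  | insert g t hg ih =>
    refine ih (fun x hx => ht x (Finset.mem_insert_of_mem hx)) ?_
    have heq : K₀ ⊔ IntermediateField.adjoin k ((insert g t : Finset K) : Set K) =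
        K₀ ⊔ IntermediateField.adjoin k (t : Set K) ⊔ IntermediateField.adjoin k {g} := by
      rw [Finset.coe_insert, Set.insert_eq, IntermediateField.adjoin_union, sup_assoc,
        sup_comm (IntermediateField.adjoin k (t : Set K))]
    rw [heq] at h
    refine H (K₀ ⊔ IntermediateField.adjoin k (t : Set K)) g
      (IntermediateField.fg_sup hK₀ (IntermediateField.fg_adjoin_finset t)) ?_ h
    exact (le_sup_left : K₀ ≤ K₀ ⊔ IntermediateField.adjoin k (t : Set K))
      (ht g (Finset.mem_insert_self g t))

/-- **Descent along any exponent-one subextension**: if `K₀ ⊆ K₁`, `K₁^p ⊆ K₀`, `K₀` is finitely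
generated and `O ∩ K₁` is uniformizable, so is `O ∩ K₀` (`K₁ = K₀(t)` for the finitely many
generators `t` of `K₁`, which exist because a uniformizable valuation ring lives on a finitely
generated field). [folklore] -/
theorem MuPQuotientStepsAt.descend {O : ValuationSubring K} (H : MuPQuotientStepsAt p k O)
    (K₀ K₁ : IntermediateField k K) (hK₀ : K₀.FG) (hle : K₀ ≤ K₁) (hpow : ∀ x ∈ K₁, x ^ p ∈ K₀)
    (h : IsLocallyUniformizable k K₁ (O.comap (algebraMap K₁ K))) :
    IsLocallyUniformizable k K₀ (O.comap (algebraMap K₀ K)) := by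
  obtain ⟨t, ht⟩ := intermediateField_fg_of_fg_top K₁ h.fg_top
  have hK₁ : K₁ = K₀ ⊔ IntermediateField.adjoin k (t : Set K) := by
    apply le_antisymm
    · rw [← ht]; exact le_sup_right
    · exact sup_le hle (ht.le)
  rw [hK₁] at h
  exact muPQuotient_tower_at O H K₀ hK₀ t
    (fun g hg => hpow g (ht ▸ IntermediateField.subset_adjoin k _ hg)) h

end Tower

/-! ## Torsor steps versus quotient steps: the Frobenius sandwich -/

section Sandwich

variable {p : ℕ} [hp : Fact p.Prime] {k K : Type u} [Field k] [CharP k p] [PerfectField k]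
  [Field K] [Algebra k K]

/-- **Quotient steps give torsor steps.** If every quotient step for `O` descends local
uniformization, every torsor step ascends it: `K₀ ↗ K₀(a^{1/p}) = K₁` is the descent
`K₀ ↘ K₁^p` (`K₀^p ⊆ K₁^p ⊆ K₀`) followed by the Frobenius transport `K₁^p ≅ K₁`. [folklore] -/
theorem MuPQuotientStepsAt.muPTorsorStepsAt {O : ValuationSubring K}
    (H : MuPQuotientStepsAt p k O) :
    MuPTorsorStepsAt p k O := by
  haveI : CharP K p := charP_of_injective_algebraMap (algebraMap k K).injective p
  haveI : ExpChar K p := ExpChar.prime hp.out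
  haveI : ExpChar k p := ExpChar.prime hp.out
  intro K₀ a ha hLU₀
  set K₁ : IntermediateField k K := K₀ ⊔ IntermediateField.adjoin k {a} with hK₁
  have hK₀fg : K₀.FG := intermediateField_fg_of_fg_top K₀ hLU₀.fg_top
  have hK₁fg : K₁.FG := IntermediateField.fg_sup hK₀fg (by
    simpa using IntermediateField.fg_adjoin_finset (F := k) ({a} : Finset K))
  -- `M = K₁^p ⊆ K₀`, and `K₀^p ⊆ M`
  have hMle : frobImage p K₁ ≤ K₀ :=
    frobImage_le fun x hx => pow_mem_of_mem_sup_adjoin_simple ha hx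
  have hK₀pow : ∀ x ∈ K₀, x ^ p ∈ frobImage p K₁ := fun x hx =>
    pow_mem_frobImage ((le_sup_left : K₀ ≤ K₁) hx)
  have hLUM := H.descend (frobImage p K₁) K₀ (frobImage_fg hK₁fg) hMle hK₀pow hLU₀
  exact (isLocallyUniformizable_frobImage_iff hp.out.pos O K₁).mpr hLUM

/-- **Torsor steps give quotient steps.** If every torsor step for `O` ascends local
uniformization, every quotient step descends it: `K₁ = K₀(a^{1/p}) ↘ K₀` is the Frobenius
transport `K₁ ≅ K₁^p` followed by the ascent `K₁^p ↗ K₀ = K₁^p(s)` along the finitely many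
generators `s` of `K₀`, whose `p`-th powers lie in `K₁^p`. [folklore] -/
theorem MuPTorsorStepsAt.muPQuotientStepsAt {O : ValuationSubring K} (H : MuPTorsorStepsAt p k O) :
    MuPQuotientStepsAt p k O := by
  haveI : CharP K p := charP_of_injective_algebraMap (algebraMap k K).injective p
  haveI : ExpChar K p := ExpChar.prime hp.out
  haveI : ExpChar k p := ExpChar.prime hp.out
  intro K₀ a hK₀fg ha hLU₁
  set K₁ : IntermediateField k K := K₀ ⊔ IntermediateField.adjoin k {a} with hK₁
  have hLUM := (isLocallyUniformizable_frobImage_iff hp.out.pos O K₁).mp hLU₁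
  have hMle : frobImage p K₁ ≤ K₀ :=
    frobImage_le fun x hx => pow_mem_of_mem_sup_adjoin_simple ha hx
  obtain ⟨s, hs⟩ := hK₀fg
  have hspow : ∀ g ∈ s, g ^ p ^ 1 ∈ frobImage p K₁ := fun g hg => by
    rw [pow_one]
    exact pow_mem_frobImage ((le_sup_left : K₀ ≤ K₁) (hs ▸ IntermediateField.subset_adjoin k _ hg))
  have h := muPTorsor_tower_at O H (frobImage p K₁) 1 s hspow hLUM
  have heq : frobImage p K₁ ⊔ IntermediateField.adjoin k (s : Set K) = K₀ := by
    apply le_antisymm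
    · exact sup_le hMle hs.le
    · rw [← hs]; exact le_sup_right
  rw [heq] at h
  exact h

/-- **Torsor steps and quotient steps are equivalent, valuation ring by valuation ring**, over a
perfect field of characteristic `p` (prime). [folklore] -/
theorem muPTorsorStepsAt_iff_muPQuotientStepsAt (O : ValuationSubring K) :
    MuPTorsorStepsAt p k O ↔ MuPQuotientStepsAt p k O :=
  ⟨MuPTorsorStepsAt.muPQuotientStepsAt, MuPQuotientStepsAt.muPTorsorStepsAt⟩

end Sandwich

/-! ## Global statements -/

/-- **The `μ_p`-torsor and the `μ_p`-quotient forms of local uniformization are equivalent**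
(unconditionally, for every prime `p`). [folklore] -/
theorem muPTorsorLocalUniformization_iff_muPQuotient {p : ℕ} [Fact p.Prime] :
    MuPTorsorLocalUniformization.{u} p ↔ MuPQuotientLocalUniformization.{u} p :=
  ⟨fun H k K _ _ _ _ _ O => MuPTorsorStepsAt.muPQuotientStepsAt (H k K O : MuPTorsorStepsAt p k O),
    fun H k K _ _ _ _ _ O => MuPQuotientStepsAt.muPTorsorStepsAt (H k K O)⟩

/-- Local uniformization over perfect fields trivially contains its quotient case. [folklore] -/
theorem LocalUniformizationPerfectInChar.muPQuotient {p : ℕ} [Fact p.Prime]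
    (h : LocalUniformizationPerfectInChar.{u} p) : MuPQuotientLocalUniformization.{u} p :=
  muPTorsorLocalUniformization_iff_muPQuotient.mp h.muPTorsor

/-- **The dual of Temkin 2013, Rem. 1.3.5 (ii)–(iii) over perfect fields**: inseparable local
uniformization (Thm. 1.3.2) and local uniformization of valuations on `μ_p`-QUOTIENTS of
uniformizable varieties give local uniformization over every perfect field of characteristic `p`.
[cite: Temkin2013, Rem. 1.3.5 (ii)-(iii) (arXiv:0804.1554v3 p. 4)] -/
theorem MuPQuotientLocalUniformization.localUniformizationPerfect {p : ℕ} [Fact p.Prime]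
    (hT : Temkin2013.{u}) (H : MuPQuotientLocalUniformization.{u} p) :
    LocalUniformizationPerfectInChar.{u} p :=
  (muPTorsorLocalUniformization_iff_muPQuotient.mpr H).localUniformizationPerfect hT

/-- **Over perfect fields, local uniformization is equivalent to its `μ_p`-quotient case**,
granted Temkin's inseparable local uniformization. [cite: Temkin2013, Rem. 1.3.5 (ii)-(iii)] -/
theorem localUniformizationPerfectInChar_iff_muPQuotient {p : ℕ} [Fact p.Prime]
    (hT : Temkin2013.{u}) :
    LocalUniformizationPerfectInChar.{u} p ↔ MuPQuotientLocalUniformization.{u} p :=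
  (localUniformizationPerfectInChar_iff hT).trans muPTorsorLocalUniformization_iff_muPQuotient

/-- **The quotient hypothesis is only needed at valuations of positive transcendence defect**
(Abhyankar valuations over perfect fields being uniformized by Knaf–Kuhlmann 2005, Thm. 1.1):
granted `Temkin2013`, local uniformization over perfect fields of characteristic `p` holds iff
every valuation ring `O ⊇ k` with `E + F < tr.deg` on a finitely generated `K/k` satisfies
`MuPQuotientStepsAt p k O`.
[cite: Temkin2013, Rem. 1.3.5 (ii)-(iii)] [cite: KnafKuhlmann2005, Thm. 1.1] -/
theorem localUniformizationPerfectInChar_iff_posDefect_muPQuotient {p : ℕ} [Fact p.Prime]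
    (hT : Temkin2013.{u}) :
    LocalUniformizationPerfectInChar.{u} p ↔
      ∀ (k K : Type u) [Field k] [CharP k p] [PerfectField k] [Field K] [Algebra k K],
        (⊤ : IntermediateField k K).FG →
        ∀ (O : ValuationSubring K) (hk : ∀ c : k, algebraMap k K c ∈ O),
          transcendenceDefect k O hk ≠ 0 → MuPQuotientStepsAt p k O := by
  rw [localUniformizationPerfectInChar_iff_posDefect hT]
  refine ⟨fun h k K _ _ _ _ _ hfg O hk hd => (h k K hfg O hk hd).muPQuotientStepsAt,
    fun h k K _ _ _ _ _ hfg O hk hd => (h k K hfg O hk hd).muPTorsorStepsAt⟩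

end Literature.AlgebraicGeometry.Resolution

end
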